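import Summits.QuantumFields.YangMills.Theorems.BalabanUVNodesN15KingModelCovariantZeroModes
import HarnessLib

/-!
# BalabanUVNodes ∕ N15 — THE KING-MODEL RUNG (PART Ͱ-f): THE SPECTRAL BOTTOM OF `−cΔ_U + m²` AT EVERY UNITARY LINK FIELD — `λ_i(M_U) ≥ m² = λ_min(M_1)` (attained by the constants at
# `U ≡ 1`), the `ℓ² → ℓ²` bound `‖G_U‖ ≤ 1∕m²`, and for `U(1)` links the massless spectrum is positive iff `U` is not a pure gauge
# (Track A, DAG node N15 = NE2; FAN-OUT v1.1 §N15 s3 «KING-MODEL RUNG … what the curved case adds»; count-neutral)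

HONEST FRAMING.  Count-neutral (cell `pub-ymgap`, seat `pub-ymgap-dag-n15-e` g42; `--supports stmt-QuantumFields-27247 --as helper` = K3ᴬ, KEY MAP v3).  One finite torus at fixed
spacing; Dodziuk–Mathai's spectral-bottom comparison on King's `A = 0` comparison model; NOT Bałaban's `G_k(U)`; NOT a node discharge (N15 of record untouched); nothing continuum ∕ OS ∕ Clay.

THE RESULTS (every period vector `K`, `c ≥ 0`, fibre `𝕜ⁿ`, unitary link field `U`; `M_U = −cΔ_U + m²` of PART Ͱ-a):
* §1 `sum_norm_fib_sq` (`Σ_x‖v_x‖² = ‖v‖²_{ℓ²}`), ★★ **`re_quadForm_covLapF_ge`** (`m²‖v‖² ≤ Re⟨v, M_Uv⟩`, from Ͱ-d's Dirichlet form);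
* §2 ★★★ **`eigenvalues_covLapF_ge_mass`** — EVERY eigenvalue of `M_U` is `≥ m²` ([DodziukMathai2006] Cor. 1.3 `λ₀(Δ) ≤ λ₀(Δ_σ)` on King's torus: the spectral bottom of the
  covariant operator lies above King's `A = 0` bottom `m²`), ★★ **`covLapF_free_mulVec_const`** (at `U ≡ 1` the fibre-constant fields are eigenvectors with eigenvalue EXACTLY `m²`:
  the bound is attained by King's operator), `eigenvalues_covLapF_pos` (`m² > 0`);
* §3 ★★★ **`norm_toLp_inv_mulVec_le`** (`‖G_Uw‖_{ℓ²} ≤ m⁻²‖w‖_{ℓ²}`) and ★★★ **`l2_opNorm_covLapF_inv_le`** (`‖G_U‖_{ℓ²→ℓ²} ≤ 1∕m²`, Mathlib `Matrix.Norms.L2Operator`) — uniformly in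
  `U`, complementing Ͱ-b's `ℓ^∞` bound and Ͱ-e's row sums;
* §4 (`U(1)` links) ★★ **`eigenvalues_covLapF_massless_pos_iff`** — all eigenvalues of the massless `−cΔ_U` are `> 0` iff `U` is NOT a pure gauge (Ͱ-d `posDef_covLapF_massless_iff` in
  spectral language): a non-trivial holonomy opens a gap at the bottom of the kinetic spectrum that King's `A = 0` operator does not have.

PRIOR TREE ART (by name): Ͱ-a (`covLapF`, `covLapF_mulVec_apply`, `isHermitian_covLapF`, `posDef_covLapF`, `covLapF_mul_inv`, `isUnit_det_covLapF`, `kingGaugeAct`, `free_mem_unitaryGroup`),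
Ͱ-b (`fib`), Ͱ-d (`re_quadForm_covLapF`, `posDef_covLapF_massless_iff`), Mathlib (`Matrix.IsHermitian.eigenvalues_eq`, `eigenvectorBasis`, `IsHermitian.posDef_iff_eigenvalues_pos`,
`Matrix.toEuclideanCLM`).  Dedup (rg at filing): basename 0 files; needles `sum_norm_fib_sq|re_quadForm_covLapF_ge|eigenvalues_covLapF_ge_mass|l2_opNorm_covLapF_inv_le|covLapF_free_mulVec_const` 0 tree
files.  Locators: [DodziukMathai2006] §1 Cor 1.3 (p0004 L77–95 of the held text); [Balaban1985BackgroundPropagators] (3.23) p.394, (3.39) p.397; [King1986] (4.4) p.670.  0 `sorry`, 0 `def`.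
-/

noncomputable section

open scoped BigOperators ComplexConjugate ComplexOrder Kronecker InnerProductSpace
open Finset Matrix WithLp

namespace Summit.QuantumFields.YangMills.BalabanUVNodes.N15KingModelRung.Covariant

open Literature.MathematicalPhysics.QuantumFieldTheory.LatticeDiamagneticInequality (Hopping blk)
open Literature.MathematicalPhysics.QuantumFieldTheory.Balaban1983to89.B5Prop11Plancherel (Tor unitVec)
open Literature.MathematicalPhysics.QuantumFieldTheory.King1986.Torus (lapF)

variable {d : ℕ} (K : Fin (d + 1) → ℕ) [hK : ∀ μ, NeZero (K μ)]
variable {𝕜 : Type*} [RCLike 𝕜] {n : Type*} [Fintype n] [DecidableEq n] {c m2 : ℝ}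

/-! ## §1 The form bound `m²‖v‖² ≤ Re⟨v, M_Uv⟩` -/

omit [DecidableEq n] in
/-- `Σ_x‖v_x‖²_{𝕜ⁿ} = ‖v‖²_{ℓ²(T×n)}`. [folklore] -/
theorem sum_norm_fib_sq (v : Tor K × n → 𝕜) : ∑ x, ‖fib K v x‖ ^ 2 = ‖(toLp 2 v : EuclideanSpace 𝕜 (Tor K × n))‖ ^ 2 := by
  rw [EuclideanSpace.norm_eq (toLp 2 v), Real.sq_sqrt (Finset.sum_nonneg fun _ _ => sq_nonneg _), Fintype.sum_prod_type]
  refine Finset.sum_congr rfl fun x _ => ?_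
  rw [EuclideanSpace.norm_eq, Real.sq_sqrt (Finset.sum_nonneg fun _ _ => sq_nonneg _)]
  rfl

/-- ★★ **THE FORM BOUND**: `m²·‖v‖² ≤ Re⟨v, (−cΔ_U+m²)v⟩` for every unitary `U`, `c ≥ 0` (PART Ͱ-d's Dirichlet form with the covariant kinetic term dropped).
[cite: Balaban1985BackgroundPropagators, (3.23) p.394; DodziukMathai2006, Cor 1.3 §1] -/
theorem re_quadForm_covLapF_ge (hc : 0 ≤ c) (m2 : ℝ) {U : Tor K × Fin (d + 1) → Matrix n n 𝕜} (hU : ∀ b, U b ∈ Matrix.unitaryGroup n 𝕜) (v : Tor K × n → 𝕜) :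
    m2 * ‖(toLp 2 v : EuclideanSpace 𝕜 (Tor K × n))‖ ^ 2 ≤ RCLike.re (star v ⬝ᵥ (covLapF K c m2 U *ᵥ v)) := by
  rw [re_quadForm_covLapF K c m2 hU v, sum_norm_fib_sq]
  have : 0 ≤ c * ∑ x, ∑ μ, ‖fib K v x - Matrix.toEuclideanLin (U (x, μ)) (fib K v (x + unitVec K μ))‖ ^ 2 := by positivity
  linarith

/-! ## §2 Every eigenvalue of `M_U` is at least `m²`; the bound is attained at `U ≡ 1` -/

/-- ★★★ **THE SPECTRAL BOTTOM IS DIAMAGNETIC**: every eigenvalue of `−cΔ_U + m²` (any unitary `U`, `c ≥ 0`) is `≥ m²` — the bottom of King's `A = 0` spectrum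
([DodziukMathai2006] Cor. 1.3 `λ₀(Δ) ≤ λ₀(Δ_σ)`, on the finite torus with a mass). [cite: DodziukMathai2006, Cor 1.3 §1; Balaban1985BackgroundPropagators, (3.23) p.394; King1986, (4.4) p.670] -/
theorem eigenvalues_covLapF_ge_mass (hc : 0 ≤ c) (m2 : ℝ) {U : Tor K × Fin (d + 1) → Matrix n n 𝕜} (hU : ∀ b, U b ∈ Matrix.unitaryGroup n 𝕜) (i : Tor K × n) :
    m2 ≤ (isHermitian_covLapF K c m2 U).eigenvalues i := by
  set hA := isHermitian_covLapF K c m2 U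
  rw [hA.eigenvalues_eq i]
  have h := re_quadForm_covLapF_ge K hc m2 hU (⇑(hA.eigenvectorBasis i))
  have hnorm : ‖(toLp 2 (⇑(hA.eigenvectorBasis i)) : EuclideanSpace 𝕜 (Tor K × n))‖ = 1 := hA.eigenvectorBasis.orthonormal.1 i
  rwa [hnorm, one_pow, mul_one] at h

/-- `m² > 0` ⟹ every eigenvalue of `M_U` is positive. [cite: DodziukMathai2006, Cor 1.3 §1] -/
theorem eigenvalues_covLapF_pos (hc : 0 ≤ c) (hm : 0 < m2) {U : Tor K × Fin (d + 1) → Matrix n n 𝕜} (hU : ∀ b, U b ∈ Matrix.unitaryGroup n 𝕜) (i : Tor K × n) :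
    0 < (isHermitian_covLapF K c m2 U).eigenvalues i :=
  hm.trans_le (eigenvalues_covLapF_ge_mass K hc m2 hU i)

/-- ★★ **THE BOUND IS ATTAINED AT `U ≡ 1`**: a field constant along the torus, `v(x,i) = e_i`, is an eigenvector of King's `M_1 = c(−Δ) ⊗ 1 + m²` with eigenvalue EXACTLY `m²` — so
`λ_min(M_1) = m² ≤ λ_min(M_U)`. [cite: King1986, (4.4) p.670; DodziukMathai2006, Cor 1.3 §1] -/
theorem covLapF_free_mulVec_const (c m2 : ℝ) (e : n → 𝕜) :
    covLapF K c m2 (Hopping.free : Tor K × Fin (d + 1) → Matrix n n 𝕜) *ᵥ (fun p => e p.2) = (m2 : 𝕜) • fun p => e p.2 := by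
  funext ⟨x, i⟩
  rw [covLapF_mulVec_apply, Pi.smul_apply, smul_eq_mul]
  simp only [Hopping.free, conjTranspose_one, Matrix.one_mulVec, Finset.sum_const, Finset.card_univ, Fintype.card_fin, nsmul_eq_mul]
  push_cast
  ring

omit hK [Fintype n] [DecidableEq n] in
/-- The constants are NON-ZERO eigenvectors whenever the fibre vector is (so `m²` IS in the spectrum of `M_1`). [folklore] -/
theorem const_ne_zero_of_ne_zero {e : n → 𝕜} (he : e ≠ 0) : (fun p : Tor K × n => e p.2) ≠ 0 := by
  obtain ⟨i, hi⟩ := Function.ne_iff.mp he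
  exact Function.ne_iff.mpr ⟨(0, i), hi⟩

/-! ## §3 `‖G_U‖_{ℓ²→ℓ²} ≤ 1∕m²` -/

omit [DecidableEq n] in
/-- Cauchy–Schwarz in `ℓ²(T × n)`: `Re(star v ⬝ᵥ w) ≤ ‖v‖‖w‖`. [folklore] -/
theorem re_star_dotProduct_le_norm_mul_norm (v w : Tor K × n → 𝕜) :
    RCLike.re (star v ⬝ᵥ w) ≤ ‖(toLp 2 v : EuclideanSpace 𝕜 (Tor K × n))‖ * ‖(toLp 2 w : EuclideanSpace 𝕜 (Tor K × n))‖ := by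
  have h : star v ⬝ᵥ w = ⟪(toLp 2 v : EuclideanSpace 𝕜 (Tor K × n)), toLp 2 w⟫_𝕜 := by rw [EuclideanSpace.inner_toLp_toLp, dotProduct_comm]
  rw [h]
  exact (RCLike.re_le_norm _).trans (norm_inner_le_norm _ _)

/-- ★★★ **`‖G_Uw‖_{ℓ²} ≤ m⁻²‖w‖_{ℓ²}`** for every unitary `U` (`c ≥ 0`, `m² > 0`): with `v = G_Uw`, `m²‖v‖² ≤ Re⟨v, M_Uv⟩ = Re⟨v, w⟩ ≤ ‖v‖‖w‖`.
[cite: DodziukMathai2006, Cor 1.3 §1; Balaban1985BackgroundPropagators, (3.39) p.397] -/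
theorem norm_toLp_inv_mulVec_le (hc : 0 ≤ c) (hm : 0 < m2) {U : Tor K × Fin (d + 1) → Matrix n n 𝕜} (hU : ∀ b, U b ∈ Matrix.unitaryGroup n 𝕜) (w : Tor K × n → 𝕜) :
    ‖(toLp 2 ((covLapF K c m2 U)⁻¹ *ᵥ w) : EuclideanSpace 𝕜 (Tor K × n))‖ ≤ m2⁻¹ * ‖(toLp 2 w : EuclideanSpace 𝕜 (Tor K × n))‖ := by
  set v := (covLapF K c m2 U)⁻¹ *ᵥ w with hv
  have hMv : covLapF K c m2 U *ᵥ v = w := by rw [hv, mulVec_mulVec, covLapF_mul_inv K hc hm hU, one_mulVec]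
  have h1 := re_quadForm_covLapF_ge K hc m2 hU v
  rw [hMv] at h1
  have h2 := re_star_dotProduct_le_norm_mul_norm K v w
  set a := ‖(toLp 2 v : EuclideanSpace 𝕜 (Tor K × n))‖ with ha
  set b := ‖(toLp 2 w : EuclideanSpace 𝕜 (Tor K × n))‖ with hb
  have ha0 : 0 ≤ a := norm_nonneg _
  have hb0 : 0 ≤ b := norm_nonneg _
  rw [le_inv_mul_iff₀ hm]
  by_cases hz : a = 0
  · rw [hz, mul_zero]; exact hb0
  · have hapos : 0 < a := lt_of_le_of_ne ha0 (Ne.symm hz)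
    nlinarith [h1, h2]

open scoped Matrix.Norms.L2Operator in
/-- ★★★ **`‖G_U‖_{ℓ²→ℓ²} ≤ 1∕m²`** in Mathlib's `L2Operator` norm, for every unitary link field (`c ≥ 0`, `m² > 0`) — uniformly in `U` and the volume.
[cite: DodziukMathai2006, Cor 1.3 §1; Balaban1985BackgroundPropagators, (3.39) p.397] -/
theorem l2_opNorm_covLapF_inv_le (hc : 0 ≤ c) (hm : 0 < m2) {U : Tor K × Fin (d + 1) → Matrix n n 𝕜} (hU : ∀ b, U b ∈ Matrix.unitaryGroup n 𝕜) :
    ‖(covLapF K c m2 U)⁻¹‖ ≤ m2⁻¹ := by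
  rw [Matrix.cstar_norm_def]
  refine ContinuousLinearMap.opNorm_le_bound _ (inv_nonneg.2 hm.le) fun w => ?_
  have hw : w = toLp 2 (ofLp w) := rfl
  rw [hw, Matrix.toEuclideanCLM_toLp]
  exact norm_toLp_inv_mulVec_le K hc hm hU (ofLp w)

/-! ## §4 `U(1)` links: the massless spectrum is positive iff `U` is not a pure gauge -/

/-- ★★ **THE MASSLESS SPECTRUM OF `−cΔ_U` IS POSITIVE IFF `U` IS NOT A PURE GAUGE** (`U(1)` links, `c > 0`) — Ͱ-d's `posDef_covLapF_massless_iff` through Mathlib's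
`posDef_iff_eigenvalues_pos`: a non-trivial holonomy opens a gap at the bottom of the covariant kinetic spectrum which King's `A = 0` operator (`U ≡ 1`, constants in the kernel)
does not have. [cite: DodziukMathai2006, Cor 1.3 §1; Balaban1985BackgroundPropagators, p.398 l.1–2] -/
theorem eigenvalues_covLapF_massless_pos_iff (hc : 0 < c) {U : Tor K × Fin (d + 1) → Matrix Unit Unit 𝕜} (hU : ∀ b, U b ∈ Matrix.unitaryGroup Unit 𝕜) :
    (∀ i, 0 < (isHermitian_covLapF K c 0 U).eigenvalues i)
      ↔ ¬ ∃ g : Tor K → Matrix Unit Unit 𝕜, (∀ x, g x ∈ Matrix.unitaryGroup Unit 𝕜) ∧ U = kingGaugeAct K g Hopping.free := by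
  rw [← (isHermitian_covLapF K c 0 U).posDef_iff_eigenvalues_pos, posDef_covLapF_massless_iff K hc hU]

/-- ★ … while at `U ≡ 1` (and on its whole gauge orbit) the massless operator has the eigenvalue `0`: some eigenvalue of `c(−Δ) ⊗ 1` vanishes. [cite: King1986, (4.4) p.670] -/
theorem exists_eigenvalue_covLapF_massless_free_eq_zero (hc : 0 < c) :
    ∃ i, (isHermitian_covLapF K c 0 (Hopping.free : Tor K × Fin (d + 1) → Matrix Unit Unit 𝕜)).eigenvalues i = 0 := by
  by_contra h
  have hall : ∀ i, 0 < (isHermitian_covLapF K c 0 (Hopping.free : Tor K × Fin (d + 1) → Matrix Unit Unit 𝕜)).eigenvalues i := fun i =>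
    lt_of_le_of_ne (eigenvalues_covLapF_ge_mass K hc.le 0 (free_mem_unitaryGroup K) i) (fun h0 => h ⟨i, h0.symm⟩)
  exact not_posDef_covLapF_massless_free K (𝕜 := 𝕜) hc (((isHermitian_covLapF K c 0 _).posDef_iff_eigenvalues_pos).mpr hall)

end Summit.QuantumFields.YangMills.BalabanUVNodes.N15KingModelRung.Covariant

end
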